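import Summits.QuantumFields.YangMills.Theorems.BalabanUVNodesN12DirectSurjHsurjProxies
import HarnessLib

/-!
# BalabanUVNodes ∕ N12 — (P4)′ SUPPORT EDITION, PRELIMINARIES: the bookkeeping lemmas of the level-ranked assembly (`…N12DirectSurjHsurjSupport`)

Cell `pub-ymgap` (HUMAN RULINGS D-0062 ∕ D-0149), WIDTH SEAT `pub-ymgap-dag-n12-w6` g8 (node N12 = [B15]; key K1⁹ `stmt-QuantumFields-27364`, `--kind proof --supports … --as helper`;
count-neutral).  THEOREMS ONLY (0 `def`, 0 `instance`, 0 `sorry`).  Split off the assembly file to respect the 400-line rule; nothing of Bałaban's is in here.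

CONTENTS.  §1 generic bookkeeping: `exists_threshold` (the arithmetic of the plaquette threshold `ε`: `D·ε < ρ`, `C₂·(D·ε)·(Cp·CΦ) ≤ ½`), `exists_placement` (a vector placed on a set of
coordinates, zero elsewhere, sup norm not larger), `exists_truncTarget` (the target truncated to the rows hosted at one site: values, norm, and «nonzero ⟹ a charged row hosted there»),
`sum_apply_eq_of_support` (a sum of vectors with pairwise disjoint supports, read at one coordinate), `sigma_mk_zero_eq_iff`.  §2 at the record: `exists_cardSeminorm` (the seminorm `p = #bonds·‖·‖_∞` with
`Σ_b ‖Y_b‖² ≤ p(Y)²`, `p ≤ Cp‖·‖`), `exists_flatBlocks_uniform` (g6's flat site blocks `…SiteBlockFlat.exists_flat_siteBlock` chosen at every `(n+1)`-site with ONE letter `CΦ ≥ 1` for the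
levels `< k`).

HONEST FRAMING.  Bookkeeping [folklore] + g6's flat site block by name; count-neutral helper; N12 NOT discharged; K1⁹ NOT closed; R4 closes only the conditional finite-`𝕋⁴` rung
`BalabanLadder.UV`; no summit statement is proved here and NOT the Yang–Mills mass gap (Clay).
-/

noncomputable section

open scoped BigOperators Matrix.Norms.L2Operator Topology NNReal
open Filter

namespace Summit.QuantumFields.YangMills.BalabanUVNodes.N12DirectSurjHsurjSupportPrelim

open Literature.MathematicalPhysics.QuantumFieldTheory.Balaban1983to89
open Node00 B15DeterminingSets
open T4Continuum (T4Family)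
open BlockAveragingEMLLinearised (linAvg)
open T4AdjointCovarianceUnitary (lieSU)
open B5Eq118OneStroke (iterBlockOf)
open B16Ineq19NearFlatSliceNorms (opNorm_coe_le_norm_lieSU)
open Summit.QuantumFields.YangMills.BalabanUVNodes.N12DirectSurjSiteBlockFlat (exists_flat_siteBlock)

/-! ## §1  Generic bookkeeping -/

section Generic

/-- The arithmetic of the plaquette threshold: for `ρ > 0` and nonnegative `C₂, Cp, CΦ, D` there is `ε > 0` with `D·ε < ρ` and `C₂·(D·ε)·(Cp·CΦ) ≤ ½` (take `ε := ρ ∕ (4(D+1)(C₂+1)(Cp·CΦ+1)(ρ+1))`).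
[folklore] -/
theorem exists_threshold {C₂ Cp CΦ ρ D : ℝ} (hC₂ : 0 ≤ C₂) (hCp : 0 ≤ Cp) (hCΦ : 0 ≤ CΦ) (hρ : 0 < ρ) (hD : 0 ≤ D) :
    ∃ ε : ℝ, 0 < ε ∧ D * ε < ρ ∧ C₂ * (D * ε) * (Cp * CΦ) ≤ 1 / 2 := by
  set Pd : ℝ := 4 * (D + 1) * ((C₂ + 1) * (Cp * CΦ + 1) * (ρ + 1)) with hPd_def
  have hM0 : 0 ≤ Cp * CΦ := mul_nonneg hCp hCΦ
  have hge1 : 1 ≤ (C₂ + 1) * (Cp * CΦ + 1) * (ρ + 1) :=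
    one_le_mul_of_one_le_of_one_le (one_le_mul_of_one_le_of_one_le (by linarith) (by nlinarith)) (by linarith)
  have hPd : 4 * (D + 1) ≤ Pd := by
    rw [hPd_def]; exact le_mul_of_one_le_right (by linarith) hge1
  have hPd0 : 0 < Pd := lt_of_lt_of_le (by linarith) hPd
  refine ⟨ρ / Pd, div_pos hρ hPd0, ?_, ?_⟩
  · rw [← mul_div_assoc, div_lt_iff₀ hPd0]
    nlinarith
  · have h1 : C₂ * (D * (ρ / Pd)) * (Cp * CΦ) = (C₂ * D * ρ * (Cp * CΦ)) / Pd := by ring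
    rw [h1, div_le_iff₀ hPd0, hPd_def]
    have h2 : C₂ * D * ρ * (Cp * CΦ) ≤ (C₂ + 1) * (D + 1) * (ρ + 1) * (Cp * CΦ + 1) :=
      mul_le_mul (mul_le_mul (mul_le_mul (by linarith) (by linarith) hD (by linarith)) (by linarith) hρ.le
        (mul_nonneg (by linarith) (by linarith))) (by linarith) hM0 (mul_nonneg (mul_nonneg (by linarith) (by linarith)) (by linarith))
    nlinarith

variable {α σ ι E : Type*} [Fintype α] [Fintype ι] [NormedAddCommGroup E]

/-- PLACEMENT: a vector `v` indexed by rows is placed on a set `S` of coordinates through the row map `e` (zero off `S`); its sup norm is not larger. [folklore] -/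
theorem exists_placement (S : Set α) (e : ∀ b, b ∈ S → ι) (v : ι → E) :
    ∃ x : α → E, (∀ (b : α) (hb : b ∈ S), x b = v (e b hb)) ∧ (∀ b, b ∉ S → x b = 0) ∧ ‖x‖ ≤ ‖v‖ := by
  classical
  refine ⟨fun b => if h : b ∈ S then v (e b h) else 0, fun b hb => dif_pos hb, fun b hb => dif_neg hb, (pi_norm_le_iff_of_nonneg (norm_nonneg v)).2 fun b => ?_⟩
  split_ifs with h
  · exact norm_le_pi_norm v _
  · rw [norm_zero]; exact norm_nonneg v

/-- TRUNCATED TARGET: the rows of `S` hosted at the site `y` carry `v`, the others `0`; sup norm not larger; a nonzero truncated target has a charged row hosted at `y`. [folklore] -/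
theorem exists_truncTarget [DecidableEq σ] (S : Set α) (e : ∀ c, c ∈ S → ι) (host : α → σ) (y : σ) (v : ι → E) :
    ∃ t : α → E, (∀ (c : α) (hc : c ∈ S), t c = if host c = y then v (e c hc) else 0) ∧ ‖t‖ ≤ ‖v‖ ∧
      (t ≠ 0 → ∃ (c : α) (hc : c ∈ S), host c = y ∧ v (e c hc) ≠ 0) := by
  classical
  refine ⟨fun c => if h : c ∈ S then (if host c = y then v (e c h) else 0) else 0, fun c hc => by simp only [dif_pos hc],
    (pi_norm_le_iff_of_nonneg (norm_nonneg v)).2 fun c => ?_, fun hne => ?_⟩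
  · split_ifs
    · exact norm_le_pi_norm v _
    · rw [norm_zero]; exact norm_nonneg v
    · rw [norm_zero]; exact norm_nonneg v
  · by_contra hall
    apply hne
    funext c
    rw [Pi.zero_apply]
    split_ifs with h1 h2
    · by_contra hvc
      exact hall ⟨c, h1, h2, hvc⟩
    · rfl
    · rfl

omit [Fintype α] [Fintype ι] in
/-- A sum of vectors whose supports sit in pairwise different blocks, read at one coordinate: only the block of that coordinate contributes. [folklore] -/
theorem sum_apply_eq_of_support [Fintype σ] {M : Type*} [AddCommMonoid M] (blk : α → σ) (X : σ → α → M) (hX : ∀ y b, X y b ≠ 0 → blk b = y) (b : α) :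
    (∑ y, X y) b = X (blk b) b := by
  classical
  rw [Finset.sum_apply, Finset.sum_eq_single (blk b)]
  · intro y _ hne
    by_contra hb
    exact hne (hX y b hb).symm
  · intro h; exact absurd (Finset.mem_univ _) h

omit [Fintype α] in
/-- Sigma bookkeeping of the level-`0` singletons: `⟨0, c⟩ = ⟨0, b₀⟩ ↔ c = b₀` in `Σ j, β j`. [folklore] -/
theorem sigma_mk_zero_eq_iff {β : ℕ → Type*} (c b₀ : β 0) : ((⟨0, c⟩ : (j : ℕ) × β j) = ⟨0, b₀⟩) ↔ c = b₀ :=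
  ⟨fun h => eq_of_heq (Sigma.mk.inj_iff.1 h).2, fun h => by rw [h]⟩

end Generic

/-! ## §2  At the record -/

section Record

variable {F : T4Family} {N : ℕ} [NeZero N] {K k : ℕ}

omit [NeZero N] in
/-- The seminorm `p := #bonds · ‖·‖_∞` on fine directions: `Σ_b ‖Y_b‖² ≤ p(Y)²` (Hilbert–Schmidt norms of the matrix entries) and `p ≤ Cp‖·‖` with `Cp := #bonds ≥ 0`. [folklore] -/
theorem exists_cardSeminorm (K N : ℕ) :
    ∃ (p : Seminorm ℝ (PBond (F.P K) 0 → lieSU (Fin N))) (Cp : ℝ), 0 ≤ Cp ∧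
      (∀ Y : PBond (F.P K) 0 → lieSU (Fin N), ∑ b, ‖(Y b : Matrix (Fin N) (Fin N) ℂ)‖ ^ 2 ≤ p Y ^ 2) ∧ (∀ Y, p Y ≤ Cp * ‖Y‖) := by
  set Cp : ℝ := (Fintype.card (PBond (F.P K) 0) : ℝ) with hCp_def
  have hCp : 0 ≤ Cp := Nat.cast_nonneg _
  let p : Seminorm ℝ (PBond (F.P K) 0 → lieSU (Fin N)) := (Fintype.card (PBond (F.P K) 0) : ℝ≥0) • normSeminorm ℝ (PBond (F.P K) 0 → lieSU (Fin N))
  have hpY : ∀ Y, p Y = Cp * ‖Y‖ := fun Y => by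
    show ((Fintype.card (PBond (F.P K) 0) : ℝ≥0) • normSeminorm ℝ (PBond (F.P K) 0 → lieSU (Fin N))) Y = _
    rw [hCp_def]; simp [NNReal.smul_def]
  refine ⟨p, Cp, hCp, fun Y => ?_, fun Y => (hpY Y).le⟩
  have h1 : ∀ b, ‖(Y b : Matrix (Fin N) (Fin N) ℂ)‖ ^ 2 ≤ ‖Y‖ ^ 2 := fun b =>
    pow_le_pow_left₀ (norm_nonneg _) ((opNorm_coe_le_norm_lieSU (Y b)).trans (norm_le_pi_norm Y b)) 2
  have hc : Cp ≤ Cp ^ 2 := by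
    rcases Nat.eq_zero_or_pos (Fintype.card (PBond (F.P K) 0)) with h | h
    · simp [hCp_def, h]
    · have : (1 : ℝ) ≤ Cp := by rw [hCp_def]; exact_mod_cast h
      nlinarith
  calc ∑ b, ‖(Y b : Matrix (Fin N) (Fin N) ℂ)‖ ^ 2 ≤ ∑ _b : PBond (F.P K) 0, ‖Y‖ ^ 2 := Finset.sum_le_sum fun b _ => h1 b
    _ = Cp * ‖Y‖ ^ 2 := by rw [Finset.sum_const, Finset.card_univ, nsmul_eq_mul]
    _ ≤ Cp ^ 2 * ‖Y‖ ^ 2 := mul_le_mul_of_nonneg_right hc (sq_nonneg _)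
    _ = p Y ^ 2 := by rw [hpY, mul_pow]

omit [NeZero N] in
/-- FLAT SITE BLOCKS WITH ONE LETTER: g6's real-linear flat site block (`…SiteBlockFlat.exists_flat_siteBlock`) chosen at every `(n+1)`-site, with ONE bound `CΦ ≥ 1` on their letters for the levels
`n < k` (the sum of the per-site letters — per instance). [cite: Balaban1985Variational, (44)–(47) p.285 (bookkeeping)] -/
theorem exists_flatBlocks_uniform (k : ℕ)
    (Q : (i : ℕ) → (PBond (F.P K) 0 → Matrix (Fin N) (Fin N) ℂ) → PBond (F.P K) i → Matrix (Fin N) (Fin N) ℂ)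
    (hQ0 : ∀ Y, Q 0 Y = Y) (hQs : ∀ (i : ℕ) (Y : PBond (F.P K) 0 → Matrix (Fin N) (Fin N) ℂ) (c : PBond (F.P K) (i + 1)), Q (i + 1) Y c = linAvg (Q i Y) c) :
    ∃ (Φf : (n : ℕ) → Site (F.P K) (n + 1) → ((PBond (F.P K) (n + 1) → lieSU (Fin N)) →ₗ[ℝ] (PBond (F.P K) 0 → lieSU (Fin N)))) (CΦ : ℝ), 1 ≤ CΦ ∧
      (∀ (n : ℕ), n < k → ∀ (y : Site (F.P K) (n + 1)) v, ‖Φf n y v‖ ≤ CΦ * ‖v‖) ∧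
      ∀ (n : ℕ) (y : Site (F.P K) (n + 1)), n + 1 ≤ (F.P K).m + (F.P K).K →
        (∀ (v : PBond (F.P K) (n + 1) → lieSU (Fin N)) (c : PBond (F.P K) (n + 1)), (c.src = y ∨ c.tgt = y) →
            Q (n + 1) (fun b => (Φf n y v b : Matrix (Fin N) (Fin N) ℂ)) c = (v c : Matrix (Fin N) (Fin N) ℂ)) ∧
        (∀ v (b : PBond (F.P K) 0), Φf n y v b ≠ 0 → iterBlockOf (n + 1) b.src = y ∧ iterBlockOf (n + 1) b.tgt = y ∧ iterBlockOf n b.src ≠ iterBlockOf n b.tgt) := by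
  classical
  have hfl : ∀ (n : ℕ) (y : Site (F.P K) (n + 1)), ∃ (Φ : (PBond (F.P K) (n + 1) → lieSU (Fin N)) →ₗ[ℝ] (PBond (F.P K) 0 → lieSU (Fin N))) (C : ℝ),
      0 ≤ C ∧ (∀ v, ‖Φ v‖ ≤ C * ‖v‖) ∧ (n + 1 ≤ (F.P K).m + (F.P K).K →
        (∀ (v : PBond (F.P K) (n + 1) → lieSU (Fin N)) (c : PBond (F.P K) (n + 1)), (c.src = y ∨ c.tgt = y) →
            Q (n + 1) (fun b => (Φ v b : Matrix (Fin N) (Fin N) ℂ)) c = (v c : Matrix (Fin N) (Fin N) ℂ)) ∧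
        (∀ v (b : PBond (F.P K) 0), Φ v b ≠ 0 → iterBlockOf (n + 1) b.src = y ∧ iterBlockOf (n + 1) b.tgt = y ∧ iterBlockOf n b.src ≠ iterBlockOf n b.tgt)) := by
    intro n y
    by_cases h : n + 1 ≤ (F.P K).m + (F.P K).K
    · obtain ⟨Φ, hQ, hsupp, C, hC, hCn⟩ := exists_flat_siteBlock (N := N) h y
      exact ⟨Φ, C, hC, hCn, fun _ => ⟨fun v c hc => hQ Q hQ0 hQs v c hc, hsupp⟩⟩
    · exact ⟨0, 0, le_rfl, fun v => by simp, fun h' => absurd h' h⟩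
  choose Φf CΦf hCΦf0 hCΦfn hΦprops using hfl
  set CΦ : ℝ := 1 + ∑ σ : (i : Fin k) × Site (F.P K) ((i : ℕ) + 1), CΦf σ.1 σ.2 with hCΦ_def
  have hCΦsum : 0 ≤ ∑ σ : (i : Fin k) × Site (F.P K) ((i : ℕ) + 1), CΦf σ.1 σ.2 := Finset.sum_nonneg fun σ _ => hCΦf0 _ _
  have hCΦle : ∀ (n : ℕ) (hn : n < k) (y : Site (F.P K) (n + 1)), CΦf n y ≤ CΦ := fun n hn y => by
    have h := Finset.single_le_sum (f := fun σ : (i : Fin k) × Site (F.P K) ((i : ℕ) + 1) => CΦf σ.1 σ.2) (fun σ _ => hCΦf0 _ _)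
      (Finset.mem_univ (⟨⟨n, hn⟩, y⟩ : (i : Fin k) × Site (F.P K) ((i : ℕ) + 1)))
    rw [hCΦ_def]
    exact le_trans h (by linarith)
  exact ⟨Φf, CΦ, by rw [hCΦ_def]; linarith, fun n hn y v => (hCΦfn n y v).trans (mul_le_mul_of_nonneg_right (hCΦle n hn y) (norm_nonneg _)), hΦprops⟩

end Record

end Summit.QuantumFields.YangMills.BalabanUVNodes.N12DirectSurjHsurjSupportPrelim

end
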